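import Summits.QuantumFields.YangMills.Theorems.ThermodynamicCeilingsTopBandTransferA
import HarnessLib

/-!
# Route `ThermodynamicCeilings` (LINE D, ym-idea-11 g5) — the load-bearing item `TopBandTransfer` (stmt-QuantumFields-27692)

`ScaleMonotonicityC → TopBandCeilingC → SqrtDominationC →` the LARGE-VOLUME factorial ceilings
`|E_T ∏ᵢ(Pᵢ − E_T Pᵢ)| ≤ (C n^κ / R⁴)ⁿ` on the odd tori `(ℤ/(2L+1))⁴` with `L ≥ L₀(β)`.

This is the `K_M` twin of the landed `TopBandTransferA` (stmt-QuantumFields-28159, `TopBandTransferA.topBandTransferA_proof`): the same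
β-uniform near-onset sub-onset anchor `σ` (`TopBandTransferA.anchor_uniform`), the same top band `R₂ := ⌊ℓ/σ⌋`, `L₀(β) := 4R₂+8`
(`TopBandTransferA.topBand_sep`), the same reflection-positivity mirror domination per torus (`MirrorDomination.abs_cov_le_of_axisMirror`)
and square-root domination per torus (`SqrtDominationC`).  The ONLY change is the transfer from the top band `t₂ = 2R₂+2` down to
`t ∈ [2R+2, t₂)`: instead of the anchored Abel transfer it is ONE application of anti-screening `K_M = ScaleMonotonicityC` at the resolution
`σ` itself (which is sub-onset), legitimate because `4 ≤ 2R+2 ≤ t ≤ t₂`, `t₂ = 2⌊ℓ/σ⌋+2 ≤ 2ℓ/σ+2` and `t₂ ≤ 4R₂+8 ≤ L`; its output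
`t⁸|c(t)| ≤ A·t₂⁸|c(t₂)|` is exactly the input of the landed `AntiScreeningCeilings.transfer_bound`.  Constants: `C_final := C₂·16·A·C_T`,
`κ := θ`, `ℓ₄ := min(ℓ_M, ℓ_T)/2`, `β₄ := max(β_M, β_T, β_D, β₅, 0)`.

Only this implication between route items is proved (the three hypotheses are OPEN cruxes); no summit / leaf / NT / UV / IR / mass-gap
statement is proved here.  Cell `ym-idea-1`, LEAD seat `ym-line-sfw-p2` g71 (free hands), `--workitem stmt-QuantumFields-27692`.
Proof text adapted from `Theorems/ThermodynamicCeilingsTopBandTransferA.lean` (same route, LINE G).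
-/

set_option autoImplicit false

noncomputable section

namespace Summit.QuantumFields.YangMills.Theorems.TopBandTransferKM

open MeasureTheory Set
open Literature.MathematicalPhysics.QuantumFieldTheory Literature.MathematicalPhysics.QuantumLattice
open Summit.QuantumFields.YangMills.Cruxes.OSLegsFromFemtoAndGap.DlrCollarTransfer
open Summit.QuantumFields.YangMills.Theses.ThermodynamicCeilings
open Summit.QuantumFields.YangMills.Theses.AntiScreeningCeilings (transfer_bound weaken_bound)
open Summit.QuantumFields.YangMills.Theorems.MirrorDomination (abs_cov_le_of_axisMirror)
open Summit.QuantumFields.YangMills.Theorems.TopBandTransferA (anchor_uniform topBand_sep)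

/-- **`TopBandTransfer` (stmt-QuantumFields-27692).** `ScaleMonotonicityC → TopBandCeilingC → SqrtDominationC →` large-volume factorial
ceilings `(C n^κ/R⁴)ⁿ` on tori `L ≥ L₀(β)`, with the β-uniform near-onset sub-onset anchor `σ`, the top band `R₂ = ⌊ℓ/σ⌋`, `L₀ = 4R₂+8`,
anti-screening at resolution `σ` from `t₂ = 2R₂+2` down to `t ≥ 2R+2` (`transfer_bound`), mirror domination and square-root domination per
torus; constants `C := C₂·16·A·C_T`, `κ := θ`, `ℓ₄ := min(ℓ_M,ℓ_T)/2`, `β₄ := max(β_M,β_T,β_D,β₅,0)`.  Only an implication between route items;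
`ScaleMonotonicityC`, `TopBandCeilingC`, `SqrtDominationC` stay open and no summit / leaf / NT / UV / IR statement is proved.
[cite: OsterwalderSeiler1978, §2; GlimmJaffe1987, §6.2; Newman1975Gaussian, Thm. 1 (role of the two-point envelope)] -/
theorem topBandTransfer_proof : TopBandTransfer := by
  intro hKM hTop hD G _ _ _ _ hG hSU
  letI : MeasurableSpace G := borel G
  haveI : BorelSpace G := ⟨rfl⟩
  intro r v f g h Λ₅
  have hKM' : Summit.QuantumFields.YangMills.Theses.AntiScreeningCeilings.ScaleMonotonicity := hKM
  have hTop' : Summit.QuantumFields.YangMills.Theses.AntiScreeningCeilings.TopBandCeiling := hTop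
  have hD' : Summit.QuantumFields.YangMills.Theses.SquareRootCeilings.SqrtDomination := hD
  obtain ⟨εA, hεA, HA⟩ := hKM' G hG hSU r v f g h Λ₅
  obtain ⟨εT, hεT, HT⟩ := hTop' G hG hSU r v f g h Λ₅
  obtain ⟨C₂, θ, βD, hC₂, hθ, HD⟩ := hD' G hG hSU r
  refine ⟨min εA εT, lt_min hεA hεT, fun ε hε hεle hfl => ?_⟩
  obtain ⟨ℓM, hℓM, HA1⟩ := HA ε hε (le_trans hεle (min_le_left _ _)) hfl
  obtain ⟨ℓT, hℓT, HT1⟩ := HT ε hε (le_trans hεle (min_le_right _ _)) hfl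
  have hℓpos : 0 < min ℓM ℓT := lt_min hℓM hℓT
  obtain ⟨A, βM, hA, HA2⟩ := HA1 (min ℓM ℓT) hℓpos (min_le_left _ _)
  obtain ⟨C, βT, hC, HT2⟩ := HT1 (min ℓM ℓT) hℓpos (min_le_right _ _)
  obtain ⟨β₅, hβ₅⟩ := hfl
  have hA0 : 0 ≤ A := le_trans zero_le_one hA
  refine ⟨C₂ * (16 * A * C), θ, min ℓM ℓT / 2, max (max (max βM βT) (max βD β₅)) 0, half_pos hℓpos,
    by positivity, hθ, ?_⟩
  intro β hβ
  have hβM : βM ≤ β := le_trans (le_trans (le_trans (le_max_left _ _) (le_max_left _ _)) (le_max_left _ _)) hβ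
  have hβT : βT ≤ β := le_trans (le_trans (le_trans (le_max_right _ _) (le_max_left _ _)) (le_max_left _ _)) hβ
  have hβD : βD ≤ β := le_trans (le_trans (le_trans (le_max_left _ _) (le_max_right _ _)) (le_max_left _ _)) hβ
  have hβ5 : β₅ ≤ β := le_trans (le_trans (le_trans (le_max_right _ _) (le_max_right _ _)) (le_max_left _ _)) hβ
  have hβ0 : (0 : ℝ) ≤ β := le_trans (le_max_right _ _) hβ
  -- a floor carrier at this β and the β-UNIFORM near-onset sub-onset anchor σ
  obtain ⟨sf, hsf0, hsf1, hPf⟩ := hβ₅ β hβ5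
  obtain ⟨σ, hσ0, hσ1, hPσ, hσsub, hσlt⟩ := anchor_uniform
    (fun s' : ℝ => (∀ L : ℕ, Λ₅ ≤ s' * L → ε ≤ Q2 G r β L s' (thetaTest 4 v) v) ∧
      (∀ L : ℕ, Λ₅ ≤ s' * L → ε ≤ |Q3 G r β L s' f g h|)) hsf0 hsf1 hPf
  -- the volume threshold
  refine ⟨4 * ⌊min ℓM ℓT / σ⌋₊ + 8, ?_⟩
  intro s hs hs1 hsub L n q x R hq hR hRs hRL hL₀ hsep
  set ℓ : ℝ := min ℓM ℓT with hℓ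
  set R₂ : ℕ := ⌊ℓ / σ⌋₊ with hR₂
  have hσs : σ < 2 * s := hσlt s hsub
  obtain ⟨hRR₂, hR₂σ, htop, hR₂1, hσℓ⟩ := topBand_sep hσ0 hσs hR hRs
  have hR₂L : 4 * R₂ + 8 ≤ L := hL₀
  have hRpos : (0 : ℝ) < R := by exact_mod_cast (lt_of_lt_of_le Nat.zero_lt_one hR)
  -- STEP A: the axis mirror ceiling on this torus, every orientation, every axis, every t ∈ [2R+2, L]
  have haxis : ∀ (q₁ : Fin 4 × Fin 4) (k : Fin 4) (t : ℕ), q₁.1 < q₁.2 → 2 * R + 2 ≤ t → t ≤ L →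
      |torusE G r β L (fun U => (plane G r q₁ (fun i => if i = k then (t : ℤ) else 0) U -
          torusE G r β L (plane G r q₁ (fun i => if i = k then (t : ℤ) else 0))) *
        (plane G r q₁ (fun _ => 0) U - torusE G r β L (plane G r q₁ (fun _ => 0))))| ≤
        (16 * A * C / (R : ℝ) ^ 4) ^ 2 := by
    intro q₁ k t hq₁ ht htL
    -- the top-band ceiling at the maximal separation R₂, on [2R₂+2, L]
    have hTb : ∀ t' : ℕ, 2 * R₂ + 2 ≤ t' → t' ≤ L →
        |torusE G r β L (fun U => (plane G r q₁ (fun i => if i = k then (t' : ℤ) else 0) U -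
            torusE G r β L (plane G r q₁ (fun i => if i = k then (t' : ℤ) else 0))) *
          (plane G r q₁ (fun _ => 0) U - torusE G r β L (plane G r q₁ (fun _ => 0))))| ≤ (C / (R₂ : ℝ) ^ 4) ^ 2 :=
      fun t' h1 h2 => HT2 β hβT σ hσ0 hσ1 hσsub ⟨σ, by linarith, hσ1, hPσ⟩ L q₁ k R₂ t' hq₁ hR₂1 hR₂σ hR₂L htop h1 h2
    rcases le_or_gt t (2 * R₂ + 2) with hle | hgt
    · -- anti-screening at the sub-onset resolution σ, from t₂ = 2R₂+2 down to t
      have hR₂R : (R₂ : ℝ) ≤ ℓ / σ := by rw [le_div_iff₀ hσ0]; exact hR₂σ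
      have ht₂w : (((2 * R₂ + 2 : ℕ) : ℝ)) ≤ 2 * ℓ / σ + 2 := by
        push_cast
        have : 2 * (R₂ : ℝ) ≤ 2 * ℓ / σ := by rw [mul_div_assoc]; linarith
        linarith
      have hM := HA2 β hβM σ hσ0 hσ1 hσsub L q₁ k t (2 * R₂ + 2) hq₁ (by omega) hle ht₂w (by omega)
      exact transfer_bound hA hR hRR₂ ht hM (hTb _ le_rfl (by omega))
    · exact weaken_bound hA hC hR hRR₂ (hTb t hgt.le htL)
  -- STEP B (reflection-positivity mirror domination, per torus) and STEP C (square-root domination, per torus)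
  rcases n with _ | _ | m
  · -- n = 0 : empty product
    simp [Summit.QuantumFields.YangMills.Cruxes.UVSeamRec.ResponsePinning.torusE_const]
  · -- n = 1 : a centred one-point function vanishes
    have h0 : (0 : ℝ) ≤ (C₂ * (16 * A * C) * (((0 + 1 : ℕ) : ℝ)) ^ θ / (R : ℝ) ^ 4) ^ (0 + 1) := by positivity
    simpa [Fin.prod_univ_one, Summit.QuantumFields.YangMills.Theses.SquareRootCeilings.torusE_plane_centred] using h0
  · set b : ℝ := (16 * A * C / (R : ℝ) ^ 4) ^ 2 with hb
    have hb0 : 0 ≤ b := sq_nonneg _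
    have hpairs : ∀ (q q' : Fin 4 × Fin 4) (x y : Fin 4 → ℤ), q.1 < q.2 → q'.1 < q'.2 →
        (∃ k : Fin 4, (2 * (R : ℤ) + 4) ≤ |((((x k - y k : ℤ) : ZMod (2 * L + 1))).valMinAbs : ℤ)|) →
        |torusE G r β L (fun U => (plane G r q x U - torusE G r β L (plane G r q x)) *
          (plane G r q' y U - torusE G r β L (plane G r q' y)))| ≤ b := by
      intro q q' x y hq hq' hk
      obtain ⟨k, hk⟩ := hk
      exact abs_cov_le_of_axisMirror G r hβ0 hR hRL (fun q₁ t hq₁ ht htL => haxis q₁ 0 t hq₁ ht htL)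
        hq hq' x y k hk
    have h16 : 0 ≤ 16 * A * C := by positivity
    have hsqrt : Real.sqrt b = 16 * A * C / (R : ℝ) ^ 4 := by
      rw [hb, Real.sqrt_sq (div_nonneg h16 (pow_nonneg (Nat.cast_nonneg _) _))]
    have key := HD β hβD L R b hR hRL hb0 hpairs (m + 2) q x hq (by omega) hsep
    calc |torusE G r β L (fun U => ∏ i, (plane G r (q i) (x i) U - torusE G r β L (plane G r (q i) (x i))))|
        ≤ (C₂ * ((m + 2 : ℕ) : ℝ) ^ θ * Real.sqrt b) ^ (m + 2) := key
      _ = (C₂ * (16 * A * C) * ((m + 2 : ℕ) : ℝ) ^ θ / (R : ℝ) ^ 4) ^ (m + 2) := by rw [hsqrt]; ring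

end Summit.QuantumFields.YangMills.Theorems.TopBandTransferKM

end
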